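import Summits.QuantumFields.YangMills.Theorems.BalabanUVNodesN11AFibreDominationRowCubeCover
import Summits.QuantumFields.YangMills.Theorems.BalabanUVNodesN11CubeCoverRowOfNesting
import Literature.MathematicalPhysics.QuantumFieldTheory.Balaban1983to89.B15Prop1Thm1GeneralFormShapes
import Literature.MathematicalPhysics.QuantumFieldTheory.Balaban1983to89.B16Stage3Regions

/-!
# DAG node N11 — THE SATURATION HYPOTHESIS OF THE A-FIBRE DOMINATION ROW IS REDUNDANT: at every history of every length the region `Λ_{j+1}ᶜ ∩ Ω_{j+1}` of the
# generation-`j` A-fibre IS a union of χ_{j+1}-cubes, from the faces' own `PartCompat₁₃` (the `𝐃_{j+1}` grid divides the torus) and the NESTING NUMERIC `L·M₂ ∣ M`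
# («M a multiple of LM₂»); hence dag-n11-w1's row at the certificate `rePinH θ` holds on the all-small branch at EVERY history, no `hsat`

HEADER — WORK-UNIT METADATA.  Cell `pub-ymgap`, YM-PLAN Track A (HUMAN RULING D-0062 ∕ D-0149 ∕ D-0154 width seats), seat `pub-ymgap-dag-n11-w5` (g0; WIDTH SEAT 5 on NODE n11
[B14]; dag-n11-d g14's hand-out «X7», INBOX l.29813), route `BalabanUVNodes` rev 25, item K1⁷ `StabilityBAtRecordR13SepCoPH` = stmt-QuantumFields-20542 (helper,
`--kind proof --supports 20542 --as helper`, count-neutral).  [III] = [Balaban1988Convergent], [I] = [Balaban1987RG1].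
Over dag-n11-w1 g0's `…N11AFibreDominationRowCubeCover` (★★ `afibre_dominated_rePinH_of_saturated` ∕ `afibre_dominated_of_saturated_of_quad_nonneg`: the (K0b) A-fibre domination
row for the all-small branch value at every history whose region `Λ_{j+1}(init s′)ᶜ ∩ Ω_{j+1}(init s′)` is χ_{j+1}-SATURATED, hypothesis `hsat`), dag-n11-w4 g3's
`…N11CubeCoverRowOfNesting` (p606678 §1–§2: `pos_of_mul_dvd_sitesPerDir`, ★★ `mem_unionsOfCubes_of_mem_unionsOfCubes_mul` — the classes of unions of `s·t`- and `s`-cubes are NESTED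
when `s·t ∣ sitesPerDir 0` —, `dCubeSide_eq_cubeSide_mul`), dag-n12's torus∕cover bridge `B15Prop1Thm1GeneralFormShapes.mem_unionsOfCubes_iff_isUnionOfCubes_cover`, and the ℤᵈ
cube-class algebra `B14DomainGeom.IsUnionOfCubes.compl` ∕ `B16Stage3Regions.isUnionOfCubes_inter`.

WHY THIS FILE.  dag-n11-w1's two rows display `hsat : (s.init.Λ (j+1))ᶜ ∩ s.init.Ω (j+1) ∈ unionsOfCubes (F.P p.K) (sideχ F θ.ν p g j)`.  It is AUTOMATIC: for a history `s` of
length `k+1` and `j+1 ≤ k`, (2.1) puts `Λ_{j+1}(init s)` and `Ω_{j+1}(init s)` in `𝐃_{j+1}` = unions of `L^{j+1}·M·R_{j+1}`-cubes (`Chain21.memΛ ∕ memΩ`); with `M = L·M₂·t`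
that side is `sideχ j · t` (`sideχ j = L^{j+2}·M₂·R_{j+1}`, the χ_{j+1}-side; `dCubeSide_eq_cubeSide_mul`), and `PartCompat₁₃ … k` says it divides the torus period; so both sets
are unions of χ_{j+1}-cubes (`mem_unionsOfCubes_of_mem_unionsOfCubes_mul`), and the class of unions of `c`-cubes, `0 < c ∣ sitesPerDir 0`, is closed under complement and
intersection (§1, through the cover bridge: the pull-back to ℤᵈ commutes with `ᶜ`, `∩`).  For `k < j+1` the index is off its window: `Ω_{j+1}(init s) = ∅` (`Seq.Ω_off`) and `∅` is
a union of no cubes.  Hence (§3) dag-n11-w1's rows with `hsat` GONE: at `rePinH θ` the (K0b) A-fibre domination conjunct holds on EVERY all-small branch `S_{j+1} = ∅` at EVERY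
history, given `PartCompat₁₃ … k`, `L·M₂ ∣ M`, `1 ≤ L`, `1 ≤ M₂`.

WHAT THIS FILE PROVES (0 `sorry`, 0 `def`; nothing of Bałaban asserted).
§1 (torus geometry, any `Params`): `compl_mem_unionsOfCubes` · `inter_mem_unionsOfCubes` · ★ `mem_unionsOfCubes_compl_inter` (the class of unions of `c`-cubes, `0 < c ∣ sitesPerDir 0`,
   is closed under `ᶜ`, `∩`, `(·)ᶜ ∩ (·)`).
§2 (the record's letters): `sideD_eq_sideχ_mul` (`M = L·M₂·t ⇒ sideD j = sideχ j · t`) · `Λ_init_mem_unionsOfCubes_sideχ` ∕ `Ω_init_mem_unionsOfCubes_sideχ` (on the window) · ★★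
   `saturated_ΛcΩ_of_partCompat_of_nesting` (`hsat` at EVERY `j` for EVERY history of length `k+1`, from `PartCompat₁₃ … k` and `L·M₂ ∣ M` ALONE).
§3 ★★ `afibre_dominated_of_quad_nonneg_of_partCompat_of_nesting` (generic `θ` under [I]'s sign `0 ≤ quad`) · ★★ `afibre_dominated_rePinH_of_partCompat_of_nesting` (at the
   certificate) — dag-n11-w1's two rows VERBATIM with `hsat` replaced by `PartCompat₁₃ … k` + `L·M₂ ∣ M`.

HONEST FRAMING.  Helper lane of K1⁷; kernel bookkeeping (torus ∕ lattice set algebra); nothing of [III]'s estimates asserted; no law of record edited or posited.  The nesting numeric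
`L·M₂ ∣ M` and `PartCompat₁₃` are HYPOTHESES (node00-def-K0a's `M = M₂ = 1` meets the former only at `L = 1` — dag-n11-d g12 ∕ dag-n11-w4's located sentence); `1 ≤ L`, `1 ≤ M₂`
displayed.  N11 NOT discharged; K1⁷ NOT closed; counts unmoved (typed 28∕28 · discharged 5∕27); no summit statement is proved by this seat.  R4 closes only the conditional
finite-𝕋⁴ rung `BalabanLadder.UV` of one programme at fixed `ε = L^{−K}` — NOT ℝ⁴, NOT OS, NOT a mass gap, NOT Clay.  No `sorry`, `axiom`, `def`, `instance`, `notation`.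
Sources (SHAPE only): [III] (2.1) p.254 («unions of big cubes»), (2.5) p.255, (2.17)–(2.18) p.257 («compatible with all other partitions»), (2.21) p.258, (3.2) p.265, (3.16) p.268,
(3.21) p.269, (3.23) p.270; [I] (0.1) p.251 (the torus).
-/

noncomputable section

open MeasureTheory
open scoped BigOperators ENNReal NNReal Matrix.Norms.L2Operator

namespace Summit.QuantumFields.YangMills.Theorems.BalabanUVNodesN11AFibreRowOfNesting

open Literature.MathematicalPhysics.QuantumFieldTheory.Balaban1983to89 T4Continuum Node00 Node00.Tk
open B10Eq42TorusConstraint (bondsIn)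
open B14DomainGeom (IsUnionOfCubes)
open B15Eq112TorusCover (cover)
open B15Prop1Thm1GeneralFormShapes (mem_unionsOfCubes_iff_isUnionOfCubes_cover)
open B16Stage3Regions (isUnionOfCubes_inter)
open BalabanUVNodesN11RePinnedParamDefs
open BalabanUVNodesN11AFibreDominationRowCubeCover (afibre_dominated_rePinH_of_saturated afibre_dominated_of_saturated_of_quad_nonneg)
open BalabanUVNodesN11CubeCoverRowOfNesting (pos_of_mul_dvd_sitesPerDir mem_unionsOfCubes_of_mem_unionsOfCubes_mul dCubeSide_eq_cubeSide_mul)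

/-! ## §1  Torus geometry: the class of unions of `c`-cubes of the grid, `0 < c ∣ sitesPerDir 0`, is closed under complement and intersection -/

section Geometry

variable {P : Params} {c : ℕ}

/-- **The complement of a union of `c`-cubes of the grid is a union of `c`-cubes** (`0 < c ∣ sitesPerDir 0`): through the cover bridge the pull-back to ℤᵈ is a union of cubes
(`IsUnionOfCubes.compl`), and pull-back commutes with complement. [cite: Balaban1988Convergent, (2.1) p.254, (2.3) p.255 («Z_k = Λ_kᶜ»), (2.17) p.257; Balaban1987RG1, (0.1) p.251] -/
theorem compl_mem_unionsOfCubes (hc : 0 < c) (hdvd : c ∣ P.sitesPerDir 0) {X : Set (Site P 0)} (hX : X ∈ unionsOfCubes P c) :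
    Xᶜ ∈ unionsOfCubes P c := by
  rw [mem_unionsOfCubes_iff_isUnionOfCubes_cover hc hdvd] at hX ⊢
  rw [Set.preimage_compl]
  exact hX.compl

/-- **The intersection of two unions of `c`-cubes of the grid is a union of `c`-cubes** (`0 < c ∣ sitesPerDir 0`). [cite: Balaban1988Convergent, (2.1) p.254, (2.17) p.257; Balaban1987RG1, (0.1) p.251] -/
theorem inter_mem_unionsOfCubes (hc : 0 < c) (hdvd : c ∣ P.sitesPerDir 0) {X Y : Set (Site P 0)} (hX : X ∈ unionsOfCubes P c)
    (hY : Y ∈ unionsOfCubes P c) : X ∩ Y ∈ unionsOfCubes P c := by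
  rw [mem_unionsOfCubes_iff_isUnionOfCubes_cover hc hdvd] at hX hY ⊢
  rw [Set.preimage_inter]
  exact isUnionOfCubes_inter hX hY

/-- **★ `Xᶜ ∩ Y` is a union of `c`-cubes of the grid when `X` and `Y` are** (`0 < c ∣ sitesPerDir 0`) — the shape of the A-fibre region `Λ_{j+1}ᶜ ∩ Ω_{j+1}`.
[cite: Balaban1988Convergent, (2.1) p.254, (2.21) p.258, (3.16) p.268; Balaban1987RG1, (0.1) p.251] -/
theorem mem_unionsOfCubes_compl_inter (hc : 0 < c) (hdvd : c ∣ P.sitesPerDir 0) {X Y : Set (Site P 0)} (hX : X ∈ unionsOfCubes P c)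
    (hY : Y ∈ unionsOfCubes P c) : Xᶜ ∩ Y ∈ unionsOfCubes P c :=
  inter_mem_unionsOfCubes hc hdvd (compl_mem_unionsOfCubes hc hdvd hX) hY

end Geometry

/-! ## §2  The record's letters: on the window both `Λ_{j+1}(init s)` and `Ω_{j+1}(init s)` are unions of χ_{j+1}-cubes; the saturation at EVERY `j` -/

section Record

variable {F : T4Family} {N : ℕ} [NeZero N]

/-- `M = L·M₂·t ⇒ sideD j = sideχ j · t`: the `𝐃_{j+1}` side `L^{j+1}·M·R_{j+1}` is the χ_{j+1}-side `L^{j+2}·M₂·R_{j+1}` times `t` (dag-n11-w4's `dCubeSide_eq_cubeSide_mul` one level up).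
[cite: Balaban1988Convergent, (2.1) p.254, (3.2) p.265, (2.17) p.257 (bookkeeping)] -/
theorem sideD_eq_sideχ_mul (ν : Stage7Numerics) {M t : ℕ} (p : B12.RunParams) (g : ℕ → ℝ) (hM : M = (F.P p.K).L * ν.M₂ * t) (j : ℕ) :
    sideD F ν M p g j = sideχ F ν p g j * t :=
  dCubeSide_eq_cubeSide_mul hM _ _

variable (θ : Stage13HParams F N) (p : B12.RunParams)

/-- **ON THE WINDOW `j+1 ≤ k`, `Λ_{j+1}(init s)` IS A UNION OF χ_{j+1}-CUBES** for every history `s` of length `k+1`: (2.1) `Chain21.memΛ` puts it in `𝐃_{j+1}`, whose side is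
`sideχ j · t` (`L·M₂ ∣ M`) and divides the torus (`PartCompat₁₃ … k`); the classes are nested (`mem_unionsOfCubes_of_mem_unionsOfCubes_mul`).
[cite: Balaban1988Convergent, (2.1) p.254, (2.5) p.255, (2.17) p.257, (3.2) p.265] -/
theorem Λ_init_mem_unionsOfCubes_sideχ (hdiv : (F.P p.K).L * θ.ν.M₂ ∣ θ.τ9.M) {k : ℕ} (hPC : PartCompat₁₃ F N θ.toStage13Params p k)
    (s : SeqOfRecord F θ.ν θ.τ9.M (gOfRecord₁₃ F N θ.toStage13Params p) p.K (k + 1)) {j : ℕ} (hjk : j + 1 ≤ k) :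
    s.init.Λ (j + 1) ∈ unionsOfCubes (F.P p.K) (sideχ F θ.ν p (gOfRecord₁₃ F N θ.toStage13Params p) j) := by
  obtain ⟨t, ht⟩ := hdiv
  have hside : sideD F θ.ν θ.τ9.M p (gOfRecord₁₃ F N θ.toStage13Params p) j = sideχ F θ.ν p (gOfRecord₁₃ F N θ.toStage13Params p) j * t :=
    sideD_eq_sideχ_mul θ.ν p _ ht j
  have hPCj : sideχ F θ.ν p (gOfRecord₁₃ F N θ.toStage13Params p) j * t ∣ (F.P p.K).sitesPerDir 0 := by
    rw [← hside]; exact hPC (j + 1) (Nat.succ_pos j) hjk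
  have hΛ : s.init.Λ (j + 1) ∈ unionsOfCubes (F.P p.K) (sideχ F θ.ν p (gOfRecord₁₃ F N θ.toStage13Params p) j * t) := by
    rw [← hside]; exact s.init.chain.memΛ (j + 1) (Nat.succ_pos j) hjk
  exact mem_unionsOfCubes_of_mem_unionsOfCubes_mul hPCj hΛ

/-- **ON THE WINDOW `j+1 ≤ k`, `Ω_{j+1}(init s)` IS A UNION OF χ_{j+1}-CUBES** (same, with `Chain21.memΩ`). [cite: Balaban1988Convergent, (2.1) p.254, (2.5) p.255, (2.17) p.257, (3.2) p.265] -/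
theorem Ω_init_mem_unionsOfCubes_sideχ (hdiv : (F.P p.K).L * θ.ν.M₂ ∣ θ.τ9.M) {k : ℕ} (hPC : PartCompat₁₃ F N θ.toStage13Params p k)
    (s : SeqOfRecord F θ.ν θ.τ9.M (gOfRecord₁₃ F N θ.toStage13Params p) p.K (k + 1)) {j : ℕ} (hjk : j + 1 ≤ k) :
    s.init.Ω (j + 1) ∈ unionsOfCubes (F.P p.K) (sideχ F θ.ν p (gOfRecord₁₃ F N θ.toStage13Params p) j) := by
  obtain ⟨t, ht⟩ := hdiv
  have hside : sideD F θ.ν θ.τ9.M p (gOfRecord₁₃ F N θ.toStage13Params p) j = sideχ F θ.ν p (gOfRecord₁₃ F N θ.toStage13Params p) j * t :=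
    sideD_eq_sideχ_mul θ.ν p _ ht j
  have hPCj : sideχ F θ.ν p (gOfRecord₁₃ F N θ.toStage13Params p) j * t ∣ (F.P p.K).sitesPerDir 0 := by
    rw [← hside]; exact hPC (j + 1) (Nat.succ_pos j) hjk
  have hΩ : s.init.Ω (j + 1) ∈ unionsOfCubes (F.P p.K) (sideχ F θ.ν p (gOfRecord₁₃ F N θ.toStage13Params p) j * t) := by
    rw [← hside]; exact s.init.chain.memΩ (j + 1) (Nat.succ_pos j) hjk
  exact mem_unionsOfCubes_of_mem_unionsOfCubes_mul hPCj hΩ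

/-- The χ_{j+1}-side is positive and divides the torus period on the window `j+1 ≤ k`, given `PartCompat₁₃ … k` and `L·M₂ ∣ M`. [cite: Balaban1988Convergent, (2.5) p.255, (2.17) p.257; Balaban1987RG1, (0.1) p.251 (bookkeeping)] -/
theorem sideχ_pos_dvd_of_partCompat_of_nesting (hdiv : (F.P p.K).L * θ.ν.M₂ ∣ θ.τ9.M) {k : ℕ} (hPC : PartCompat₁₃ F N θ.toStage13Params p k)
    {j : ℕ} (hjk : j + 1 ≤ k) :
    0 < sideχ F θ.ν p (gOfRecord₁₃ F N θ.toStage13Params p) j ∧ sideχ F θ.ν p (gOfRecord₁₃ F N θ.toStage13Params p) j ∣ (F.P p.K).sitesPerDir 0 := by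
  obtain ⟨t, ht⟩ := hdiv
  have hside : sideD F θ.ν θ.τ9.M p (gOfRecord₁₃ F N θ.toStage13Params p) j = sideχ F θ.ν p (gOfRecord₁₃ F N θ.toStage13Params p) j * t :=
    sideD_eq_sideχ_mul θ.ν p _ ht j
  have hPCj : sideχ F θ.ν p (gOfRecord₁₃ F N θ.toStage13Params p) j * t ∣ (F.P p.K).sitesPerDir 0 := by
    rw [← hside]; exact hPC (j + 1) (Nat.succ_pos j) hjk
  exact ⟨(pos_of_mul_dvd_sitesPerDir hPCj).1, (dvd_mul_right _ _).trans hPCj⟩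

/-- **★★ THE SATURATION AT EVERY GENERATION FOR EVERY HISTORY, FROM `PartCompat₁₃` AND THE NESTING NUMERIC ALONE**: for every history `s` of length `k+1` and every `j`, the
region `Λ_{j+1}(init s)ᶜ ∩ Ω_{j+1}(init s)` of the generation-`j` A-fibre is a union of χ_{j+1}-cubes — dag-n11-w1's `hsat` VERBATIM.  On the window by §1 and the two lemmas above;
off the window (`k < j+1`) the region is `∅` (`Seq.Ω_off`). [cite: Balaban1988Convergent, (2.1) p.254, (2.17)–(2.18) p.257, (2.21) p.258, (3.2) p.265, (3.16) p.268; Balaban1987RG1, (0.1) p.251] -/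
theorem saturated_ΛcΩ_of_partCompat_of_nesting (hdiv : (F.P p.K).L * θ.ν.M₂ ∣ θ.τ9.M) {k : ℕ} (hPC : PartCompat₁₃ F N θ.toStage13Params p k)
    (s : SeqOfRecord F θ.ν θ.τ9.M (gOfRecord₁₃ F N θ.toStage13Params p) p.K (k + 1)) (j : ℕ) :
    (s.init.Λ (j + 1))ᶜ ∩ s.init.Ω (j + 1) ∈ unionsOfCubes (F.P p.K) (sideχ F θ.ν p (gOfRecord₁₃ F N θ.toStage13Params p) j) := by
  by_cases hjk : j + 1 ≤ k
  · obtain ⟨hpos, hdvd⟩ := sideχ_pos_dvd_of_partCompat_of_nesting θ p hdiv hPC hjk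
    exact mem_unionsOfCubes_compl_inter hpos hdvd (Λ_init_mem_unionsOfCubes_sideχ θ p hdiv hPC s hjk)
      (Ω_init_mem_unionsOfCubes_sideχ θ p hdiv hPC s hjk)
  · rw [s.init.Ω_off (j + 1) (fun h => hjk h.2), Set.inter_empty]
    exact empty_mem_unionsOfCubes _ _

end Record

/-! ## §3  ★★ dag-n11-w1's two rows with the saturation hypothesis DISCHARGED -/

section Row

variable {F : T4Family} {N : ℕ} [NeZero N]
variable (θ : Stage13HParams F N) (p : B12.RunParams)

/-- **★★ THE ROW FOR THE ALL-SMALL BRANCH VALUE, generic `θ` under [I]'s sign `0 ≤ quad`, AT EVERY HISTORY** — dag-n11-w1's `afibre_dominated_of_saturated_of_quad_nonneg` with `hsat`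
replaced by `PartCompat₁₃ … k` and `L·M₂ ∣ M` (§2 `saturated_ΛcΩ_of_partCompat_of_nesting`); every other hypothesis and the conclusion VERBATIM.
[cite: Balaban1988Convergent, (2.21) p.258, (3.16) p.268, (3.21) p.269, (2.1) p.254, (2.17) p.257] -/
theorem afibre_dominated_of_quad_nonneg_of_partCompat_of_nesting (hL : 1 ≤ (F.P p.K).L) (hM₂ : 1 ≤ θ.ν.M₂)
    (hdiv : (F.P p.K).L * θ.ν.M₂ ∣ θ.τ9.M) {k : ℕ} (hPC : PartCompat₁₃ F N θ.toStage13Params p k)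
    (s : SeqOfRecord F θ.ν θ.τ9.M (gOfRecord₁₃ F N θ.toStage13Params p) p.K (k + 1)) (j : ℕ)
    (hq : ∀ ω : MultiCfg (F.P p.K) (SU N) (FluctV N), 0 ≤ (θ.zhAt p s).quad j (s.init.Λ (j + 1)) ω)
    (S : ℕ → Set (Site (F.P p.K) 0)) (hS : S (j + 1) = ∅) :
    ∃ ŵ : (↥(Set.toFinite (bondsIn j ((s.init.Λ (j + 1))ᶜ ∩ s.init.Ω (j + 1)))).toFinset → FluctV N) → ℝ≥0∞, Measurable ŵ ∧
      (∫⁻ a, ŵ a ∂(Measure.pi fun _ : ↥(Set.toFinite (bondsIn j ((s.init.Λ (j + 1))ᶜ ∩ s.init.Ω (j + 1)))).toFinset => (volume : Measure (FluctV N)))) ≠ ⊤ ∧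
      ∀ ω, ENNReal.ofReal ((WtOfRecord₁₃H F N θ p s).w j (s.init.Λ (j + 1)) ((s.init.Λ (j + 1))ᶜ ∩ s.init.Ω (j + 1)) (S (j + 1)) ω) ≤
        ŵ (fun b : ↥(Set.toFinite (bondsIn j ((s.init.Λ (j + 1))ᶜ ∩ s.init.Ω (j + 1)))).toFinset => (ω j).2 b) :=
  afibre_dominated_of_saturated_of_quad_nonneg θ p hL hM₂ s j hq (saturated_ΛcΩ_of_partCompat_of_nesting θ p hdiv hPC s j) S hS

/-- **★★ THE ROW AT THE CERTIFICATE FOR THE ALL-SMALL BRANCH VALUE AT EVERY HISTORY** (`rePinH θ`, `quad ≡ 0`): the (K0b) A-fibre domination row of generation `j` at EVERY history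
`s` of length `k+1` — dag-n11-w1's `afibre_dominated_rePinH_of_saturated` with `hsat` replaced by `PartCompat₁₃ … k` and `L·M₂ ∣ M`; every other hypothesis and the conclusion
VERBATIM.  So at the certificate the A-fibre domination conjunct of dag-n11-e's `ResidualRowsAt` holds on every all-small branch `S_{j+1} = ∅`, given `PartCompat₁₃`, `L·M₂ ∣ M`,
`1 ≤ L`, `1 ≤ M₂` — nothing else. [cite: Balaban1988Convergent, (2.21) p.258, (3.16) p.268, (3.21) p.269, (3.23) p.270, (2.1) p.254, (2.17) p.257] -/
theorem afibre_dominated_rePinH_of_partCompat_of_nesting (hL : 1 ≤ (F.P p.K).L) (hM₂ : 1 ≤ θ.ν.M₂)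
    (hdiv : (F.P p.K).L * θ.ν.M₂ ∣ θ.τ9.M) {k : ℕ} (hPC : PartCompat₁₃ F N θ.toStage13Params p k)
    (s : SeqOfRecord F θ.ν θ.τ9.M (gOfRecord₁₃ F N θ.toStage13Params p) p.K (k + 1)) (j : ℕ)
    (S : ℕ → Set (Site (F.P p.K) 0)) (hS : S (j + 1) = ∅) :
    ∃ ŵ : (↥(Set.toFinite (bondsIn j ((s.init.Λ (j + 1))ᶜ ∩ s.init.Ω (j + 1)))).toFinset → FluctV N) → ℝ≥0∞, Measurable ŵ ∧
      (∫⁻ a, ŵ a ∂(Measure.pi fun _ : ↥(Set.toFinite (bondsIn j ((s.init.Λ (j + 1))ᶜ ∩ s.init.Ω (j + 1)))).toFinset => (volume : Measure (FluctV N)))) ≠ ⊤ ∧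
      ∀ ω, ENNReal.ofReal ((WtOfRecord₁₃H F N (rePinH θ) p s).w j (s.init.Λ (j + 1)) ((s.init.Λ (j + 1))ᶜ ∩ s.init.Ω (j + 1)) (S (j + 1)) ω) ≤
        ŵ (fun b : ↥(Set.toFinite (bondsIn j ((s.init.Λ (j + 1))ᶜ ∩ s.init.Ω (j + 1)))).toFinset => (ω j).2 b) :=
  afibre_dominated_rePinH_of_saturated θ p hL hM₂ s j (saturated_ΛcΩ_of_partCompat_of_nesting θ p hdiv hPC s j) S hS

end Row

end Summit.QuantumFields.YangMills.Theorems.BalabanUVNodesN11AFibreRowOfNesting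

end
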